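import Summits.QuantumFields.YangMills.Theorems.UnitScaleTiltProp7MassivePropagatorAgmonLetters
import HarnessLib

/-!
# Route `UnitScaleTilt`, crux K1 «MinimiserStabilityRegPr» (stmt-QuantumFields-19200), EX row `hGF[Lift]` (curved member) — **LOD LINE, PEN (L5″) (M-III):
# THE TOP NESTED MEANS OF TWO REGULAR BACKGROUNDS AGREE WHERE BOTH COMB FRAMES ARE NEAR `1`** — the supplier of the two DISPLAYED two-tower rows `hQw`∕`hQz` of
✓`Prop7CutoffMassFormRows.abs_re_inner_twisted_massive_le` (px5 p752370), in exactly their shape.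

Cell `ym3-torus` (HUMAN RULING D-0037, YM ladder rung R3 — NOT d = 4, NOT infinite volume, NOT a mass gap, NOT Clay).  Width seat `ym3-torus-px5` gen 11; ★p1 g24 LOCATE-L6-ASSEMBLY
§1 Step I.2 (L5″), road (α); this seat's LOCATE-L5pp-localisation (4aeb694e) §(M).  THEOREMS ONLY (0 `def`, 0 `sorry`); `--supports stmt-QuantumFields-19200 --as helper`, count-neutral.  HONEST LABEL (★★OWNER RULING №33 (6)): curved γ-row supplier line (LOD localisation), pen (L5″); what remains DISPLAYED after this file is purely GEOMETRIC — the
corner-comb frames `C^W_{K−n,Y,x} = (axialT W♭ (corner Y) Y♯)⁻¹·axialT W♭ (corner Y) x` of ROW-T (✓`Prop7NestedMeanTowerClosenessT3`) are `δ`-close to `1` on the blocks `Y` meeting the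
cut-off (for a background `δ′`-flat on those blocks this is the axial-gauge walk bound, `O(L^{K−n}δ′)`); nothing of (3.49), Thm 3.1∕3.3, `h349`, `hGF`, EX ∕ 19200 is proved here.

MATHEMATICS.  For ONE field `λ` and two backgrounds `V`, `U` at `RegPr`, `10⁷L³ε₀ ≤ 1`, ROW-T's tower closeness (✓`norm_ns_sub_refMean_le_of_lt` + ✓`hclose_T3`) puts each top nested
mean within `2Ση_j ≤ 4500L²ε₀` of its REFERENCE MEAN `((L^d)^{K−n})⁻¹Σ_{x∈B(Y)} Ad_{C_{Y,x}}λ(x)` (relative to the block `ℓ¹`-mean of `‖λ‖`); the two reference means differ by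
`≤ (2δ_V + 2δ_U)`·mean since `‖Ad_C a − a‖ ≤ 2‖C − 1‖‖a‖` on `U1` (§1).  Hence §2∕§3: `‖(Q″_V λ)(Y) − (Q″_U λ)(Y)‖ ≤ (9000L²ε₀ + 2δ_V + 2δ_U)·((L^d)^{K−n})⁻¹Σ_{B(Y)}‖λ x‖`, and §4 —
block-locality of `Q″`, Cauchy–Schwarz per block, orthogonality of block lifts with disjoint supports — the two `L²` rows with `δ_Q = √(2κ)·(9000L²ε₀ + 2δ_V + 2δ_U)`,
`κ = c₁((L^d)^{K−n})⁻¹∕c₀`, the frame hypotheses asked only on blocks meeting `supp χ` (`|χ| ≤ 1`).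

References: T. Bałaban, CMP **98** (1985) 17–51 [Balaban1985Averaging] ((19)–(20) p.21, (82) p.30, (97) p.32); CMP **99** (1985) 389–434 [Balaban1985BackgroundPropagators]
((3.16), (3.19) p.393, (3.24) p.394); CMP **95** (1984) 17–40 [Balaban1984PropagatorsI] ((1.18) p.20).
-/

set_option autoImplicit false

noncomputable section

open scoped BigOperators Matrix.Norms.L2Operator InnerProductSpace ComplexConjugate

namespace Summit.QuantumFields.YangMills.Theorems.Prop7TopMeanTwoBackgrounds

open Literature.MathematicalPhysics.QuantumFieldTheory.Balaban1983to89
open Finset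
open T4Continuum BlockAveraging
open BlockAveraging (Idx)
open B7Prop1Explicit (U1 mem_U1 treeWord disp norm_inv_sub_one_le)
open B7Eq78Linearization (conjR conjR_apply conjR_sub)
open B8Ineq132 (norm_conjR)
open B5Eq118OneStroke (iterBlockOf iterBlock mem_iterBlock)
open B15DeterminingSets (embIter)
open B10Eq27TorusAxialLog (holT axialT transl unitsField toUField)
open B7TransferAnalyticMean (meanCLM)
open B9Eq311L2Pairing (WL2)
open B11Eq103H1Complex (SiteL2K)
open Summit.QuantumFields.YangMills.Theorems.Prop8Chart (emlIterU)
open Summit.QuantumFields.YangMills.Theorems.Prop7NestedMeanPoincare (hstep_of_hsucc norm_ns_sub_refMean_le_of_lt)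
open Literature.MathematicalPhysics.QuantumFieldTheory.Balaban1983to89.T3ContinuumYM3Torus
open T3SectALandauChart (eta eta_pos bgUnits)
open T3PrintedRegularMinimiser (RegPr)
open Summit.QuantumFields.YangMills.Theorems.Prop7SectET3Transport (periodsT3)
open Summit.QuantumFields.YangMills.Theorems.Prop7SectET3HilbertLetters (W₂ toL2S)
open Summit.QuantumFields.YangMills.Theorems.Prop7SymAvgTwSym (holT_mem_U1 emlIterU_bgUnits_mem_U1_of_regPr)
open Summit.QuantumFields.YangMills.Theorems.Prop7NestedMeanTowerCloseness (ref_T3_mem_U1 ref_T3_zero_self hclose_T3 two_mul_sum_eta_le_T3)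
open Summit.QuantumFields.YangMills.Theorems.Prop7LaplaceAFlatLetters (norm_sq_toL2S)
open Summit.QuantumFields.YangMills.Theorems.Prop7TopMeanBlockLocal (topMean_apply_eq_of_eqOn_iterBlock)
open Summit.QuantumFields.YangMills.Theorems.Prop7TopMeanAdjointBlockLocal (inner_blockLift_eq_zero_of_disjoint)
open Summit.QuantumFields.YangMills.Theorems.Prop7BlockBumpExtension (normSq_toL2S_comp_siteShift_eq sum_eq_sum_iterBlock)
open Summit.QuantumFields.YangMills.Theorems.Prop7CovariantCoercivity (sum_norm_sq_le_mul_opNorm_sq)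
open Summit.QuantumFields.YangMills.Theorems.Prop7MassivePropagatorAgmonLetters (norm_topMean_le normSq_lift_topMean_le norm_toL2S_smul_le)
open T3PrintedRegularOrbits (sites_eq)
open T3LevelShift (siteShift)

variable (F : T3Family) {n K : ℕ}

/-- `‖Ad_u a − a‖ ≤ 2‖u − 1‖‖a‖` for `u ∈ U1` (`Ad_u a − a = (u − 1)·a·u⁻¹ + a·(u⁻¹ − 1)`, `‖u⁻¹‖ ≤ 1`, `‖u⁻¹ − 1‖ ≤ ‖u − 1‖`). [folklore]
[cite: Balaban1985Averaging, (19)-(20) p.21] -/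
theorem norm_conjR_sub_self_le {u : (Matrix (Fin 2) (Fin 2) ℂ)ˣ} (hu : u ∈ U1 (Matrix (Fin 2) (Fin 2) ℂ)) (a : Matrix (Fin 2) (Fin 2) ℂ) :
    ‖conjR u a - a‖ ≤ 2 * ‖(u : Matrix (Fin 2) (Fin 2) ℂ) - 1‖ * ‖a‖ := by
  have hu2 : ‖((u⁻¹ : (Matrix (Fin 2) (Fin 2) ℂ)ˣ) : Matrix (Fin 2) (Fin 2) ℂ)‖ ≤ 1 := (mem_U1.mp hu).2
  have hinv : ‖((u⁻¹ : (Matrix (Fin 2) (Fin 2) ℂ)ˣ) : Matrix (Fin 2) (Fin 2) ℂ) - 1‖ ≤ ‖(u : Matrix (Fin 2) (Fin 2) ℂ) - 1‖ := norm_inv_sub_one_le hu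
  have e : conjR u a - a = ((u : Matrix (Fin 2) (Fin 2) ℂ) - 1) * a * ((u⁻¹ : (Matrix (Fin 2) (Fin 2) ℂ)ˣ) : Matrix (Fin 2) (Fin 2) ℂ) + a * (((u⁻¹ : (Matrix (Fin 2) (Fin 2) ℂ)ˣ) : Matrix (Fin 2) (Fin 2) ℂ) - 1) := by
    rw [conjR_apply]; simp only [sub_mul, mul_sub, one_mul, mul_one]; abel
  rw [e]
  calc ‖((u : Matrix (Fin 2) (Fin 2) ℂ) - 1) * a * ((u⁻¹ : (Matrix (Fin 2) (Fin 2) ℂ)ˣ) : Matrix (Fin 2) (Fin 2) ℂ) + a * (((u⁻¹ : (Matrix (Fin 2) (Fin 2) ℂ)ˣ) : Matrix (Fin 2) (Fin 2) ℂ) - 1)‖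
      ≤ ‖((u : Matrix (Fin 2) (Fin 2) ℂ) - 1) * a * ((u⁻¹ : (Matrix (Fin 2) (Fin 2) ℂ)ˣ) : Matrix (Fin 2) (Fin 2) ℂ)‖ + ‖a * (((u⁻¹ : (Matrix (Fin 2) (Fin 2) ℂ)ˣ) : Matrix (Fin 2) (Fin 2) ℂ) - 1)‖ := norm_add_le _ _
    _ ≤ ‖(u : Matrix (Fin 2) (Fin 2) ℂ) - 1‖ * ‖a‖ * ‖((u⁻¹ : (Matrix (Fin 2) (Fin 2) ℂ)ˣ) : Matrix (Fin 2) (Fin 2) ℂ)‖ + ‖a‖ * ‖((u⁻¹ : (Matrix (Fin 2) (Fin 2) ℂ)ˣ) : Matrix (Fin 2) (Fin 2) ℂ) - 1‖ :=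
        add_le_add ((norm_mul_le _ _).trans (mul_le_mul_of_nonneg_right (norm_mul_le _ _) (norm_nonneg _))) (norm_mul_le _ _)
    _ ≤ ‖(u : Matrix (Fin 2) (Fin 2) ℂ) - 1‖ * ‖a‖ * 1 + ‖a‖ * ‖(u : Matrix (Fin 2) (Fin 2) ℂ) - 1‖ := by gcongr
    _ = 2 * ‖(u : Matrix (Fin 2) (Fin 2) ℂ) - 1‖ * ‖a‖ := by ring

/-! ## §2 Two towers, one field: the top nested means differ by the tower defects plus the frame defects -/

/-- ★★ **TWO-BACKGROUND COMPARISON OF THE TOP NESTED COVARIANT MEAN, POINTWISE**: at `RegPr F n K ε₀ V∕U`, `10⁷L³ε₀ ≤ 1`, for the averaging sequences `nsV`, `nsU` of the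
SAME `l` (the `h0`∕`hsucc` recursions VERBATIM) and a top block `Y` whose ROW-T corner-comb frames satisfy `‖C^V − 1‖ ≤ δ_V`, `‖C^U − 1‖ ≤ δ_U` on `B(Y)`:
`‖nsV (K − n) Y − nsU (K − n) Y‖ ≤ (2·4500L²ε₀ + 2δ_V + 2δ_U)·((L^d)^{K−n})⁻¹·Σ_{x ∈ B(Y)}‖l x‖` (✓`norm_ns_sub_refMean_le_of_lt` + ✓`hclose_T3` + ✓`two_mul_sum_eta_le_T3` twice, §1
between the reference means). [cite: Balaban1985Averaging, (82) p.30, (97) p.32, (19)-(20) p.21; Balaban1985BackgroundPropagators, (3.19) p.393, (3.24) p.394] -/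
theorem norm_nsTop_sub_nsTop_le {ε₀ : ℝ} (hε₀ : 0 < ε₀) (hε7 : 10 ^ 7 * (F.L : ℝ) ^ 3 * ε₀ ≤ 1)
    (V U : GaugeField (F.P K) 0 (Matrix.specialUnitaryGroup (Fin 2) ℂ)) (hreg : RegPr F n K ε₀ V) (hregU : RegPr F n K ε₀ U)
    (l : Site (F.P K) 0 → Matrix (Fin 2) (Fin 2) ℂ)
    (nsV : (j : ℕ) → Site (F.P K) j → Matrix (Fin 2) (Fin 2) ℂ) (h0V : nsV 0 = l)
    (hsuccV : ∀ (j : ℕ) (y : Site (F.P K) (j + 1)), nsV (j + 1) y = nsV j (emb y) - meanCLM (Idx (F.P K)) (Matrix (Fin 2) (Fin 2) ℂ) fun i : Idx (F.P K) =>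
        nsV j (emb y) - ((holT (emlIterU j (bgUnits F K V)) (emb y) (stairWord i.2.1 (off i.1)) : (Matrix (Fin 2) (Fin 2) ℂ)ˣ) : Matrix (Fin 2) (Fin 2) ℂ) *
          nsV j (transl (emb y) (disp (stairWord i.2.1 (off i.1)))) * (((holT (emlIterU j (bgUnits F K V)) (emb y) (stairWord i.2.1 (off i.1)))⁻¹ : (Matrix (Fin 2) (Fin 2) ℂ)ˣ) : Matrix (Fin 2) (Fin 2) ℂ))
    (nsU : (j : ℕ) → Site (F.P K) j → Matrix (Fin 2) (Fin 2) ℂ) (h0U : nsU 0 = l)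
    (hsuccU : ∀ (j : ℕ) (y : Site (F.P K) (j + 1)), nsU (j + 1) y = nsU j (emb y) - meanCLM (Idx (F.P K)) (Matrix (Fin 2) (Fin 2) ℂ) fun i : Idx (F.P K) =>
        nsU j (emb y) - ((holT (emlIterU j (bgUnits F K U)) (emb y) (stairWord i.2.1 (off i.1)) : (Matrix (Fin 2) (Fin 2) ℂ)ˣ) : Matrix (Fin 2) (Fin 2) ℂ) *
          nsU j (transl (emb y) (disp (stairWord i.2.1 (off i.1)))) * (((holT (emlIterU j (bgUnits F K U)) (emb y) (stairWord i.2.1 (off i.1)))⁻¹ : (Matrix (Fin 2) (Fin 2) ℂ)ˣ) : Matrix (Fin 2) (Fin 2) ℂ))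
    (Y : Site (F.P K) (K - n)) {δV δU : ℝ}
    (hCV : ∀ x ∈ iterBlock (K - n) Y, ‖(((axialT (bgUnits F K V) (Site.fibreSite 0 (K - n) (iterBlockOf (K - n) x) fun _ => (⟨0, pow_pos (F.P K).L_pos (K - n)⟩ : Fin ((F.P K).L ^ (K - n)))) (embIter (K - n) Y))⁻¹ *
          axialT (bgUnits F K V) (Site.fibreSite 0 (K - n) (iterBlockOf (K - n) x) fun _ => (⟨0, pow_pos (F.P K).L_pos (K - n)⟩ : Fin ((F.P K).L ^ (K - n)))) x : (Matrix (Fin 2) (Fin 2) ℂ)ˣ) : Matrix (Fin 2) (Fin 2) ℂ) - 1‖ ≤ δV)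
    (hCU : ∀ x ∈ iterBlock (K - n) Y, ‖(((axialT (bgUnits F K U) (Site.fibreSite 0 (K - n) (iterBlockOf (K - n) x) fun _ => (⟨0, pow_pos (F.P K).L_pos (K - n)⟩ : Fin ((F.P K).L ^ (K - n)))) (embIter (K - n) Y))⁻¹ *
          axialT (bgUnits F K U) (Site.fibreSite 0 (K - n) (iterBlockOf (K - n) x) fun _ => (⟨0, pow_pos (F.P K).L_pos (K - n)⟩ : Fin ((F.P K).L ^ (K - n)))) x : (Matrix (Fin 2) (Fin 2) ℂ)ˣ) : Matrix (Fin 2) (Fin 2) ℂ) - 1‖ ≤ δU) :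
    ‖nsV (K - n) Y - nsU (K - n) Y‖
      ≤ (2 * (4500 * (F.L : ℝ) ^ 2 * ε₀) + 2 * δV + 2 * δU) * (((((F.P K).L : ℝ) ^ (F.P K).d) ^ (K - n))⁻¹ * ∑ x ∈ iterBlock (K - n) Y, ‖l x‖) := by
  have hk₀ : K - n ≤ (F.P K).m + (F.P K).K := by show K - n ≤ F.m + K; have := F.hm; omega
  have hcloseV := hclose_T3 F hε₀ hε7 V hreg.plaqSmall
  have hcloseU := hclose_T3 F hε₀ hε7 U hregU.plaqSmall
  set TV : (j : ℕ) → Site (F.P K) (j + 1) → Idx (F.P K) → (Matrix (Fin 2) (Fin 2) ℂ)ˣ :=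
    fun j y i => holT (emlIterU j (bgUnits F K V)) (emb y) (stairWord i.2.1 (off i.1)) with hTVdef
  set TU : (j : ℕ) → Site (F.P K) (j + 1) → Idx (F.P K) → (Matrix (Fin 2) (Fin 2) ℂ)ˣ :=
    fun j y i => holT (emlIterU j (bgUnits F K U)) (emb y) (stairWord i.2.1 (off i.1)) with hTUdef
  have hTV : ∀ j, j < K - n → ∀ (y : Site (F.P K) (j + 1)) (i : Idx (F.P K)), TV j y i ∈ U1 (Matrix (Fin 2) (Fin 2) ℂ) :=
    fun j hj y i => holT_mem_U1 (fun b => emlIterU_bgUnits_mem_U1_of_regPr F hε₀ hε7 hreg hj.le b) _ _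
  have hTU : ∀ j, j < K - n → ∀ (y : Site (F.P K) (j + 1)) (i : Idx (F.P K)), TU j y i ∈ U1 (Matrix (Fin 2) (Fin 2) ℂ) :=
    fun j hj y i => holT_mem_U1 (fun b => emlIterU_bgUnits_mem_U1_of_regPr F hε₀ hε7 hregU hj.le b) _ _
  have hstepV : ∀ j, j < K - n → ∀ (y : Site (F.P K) (j + 1)),
      nsV (j + 1) y = ((Fintype.card (Idx (F.P K)) : ℝ)⁻¹) • ∑ i : Idx (F.P K), conjR (TV j y i) (nsV j (Site.blockSite y i.1)) :=
    fun j _ y => hstep_of_hsucc TV nsV hsuccV j y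
  have hstepU : ∀ j, j < K - n → ∀ (y : Site (F.P K) (j + 1)),
      nsU (j + 1) y = ((Fintype.card (Idx (F.P K)) : ℝ)⁻¹) • ∑ i : Idx (F.P K), conjR (TU j y i) (nsU j (Site.blockSite y i.1)) :=
    fun j _ y => hstep_of_hsucc TU nsU hsuccU j y
  set CV : (j : ℕ) → Site (F.P K) j → Site (F.P K) 0 → (Matrix (Fin 2) (Fin 2) ℂ)ˣ :=
    fun j z x => (axialT (bgUnits F K V) (Site.fibreSite 0 (K - n) (iterBlockOf (K - n) x) fun _ => (⟨0, pow_pos (F.P K).L_pos (K - n)⟩ : Fin ((F.P K).L ^ (K - n)))) (embIter j z))⁻¹ * axialT (bgUnits F K V) (Site.fibreSite 0 (K - n) (iterBlockOf (K - n) x) fun _ => (⟨0, pow_pos (F.P K).L_pos (K - n)⟩ : Fin ((F.P K).L ^ (K - n)))) x with hCVdef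
  set CU : (j : ℕ) → Site (F.P K) j → Site (F.P K) 0 → (Matrix (Fin 2) (Fin 2) ℂ)ˣ :=
    fun j z x => (axialT (bgUnits F K U) (Site.fibreSite 0 (K - n) (iterBlockOf (K - n) x) fun _ => (⟨0, pow_pos (F.P K).L_pos (K - n)⟩ : Fin ((F.P K).L ^ (K - n)))) (embIter j z))⁻¹ * axialT (bgUnits F K U) (Site.fibreSite 0 (K - n) (iterBlockOf (K - n) x) fun _ => (⟨0, pow_pos (F.P K).L_pos (K - n)⟩ : Fin ((F.P K).L ^ (K - n)))) x with hCUdef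
  have hCV1 : ∀ j, j ≤ K - n → ∀ (z : Site (F.P K) j) (x : Site (F.P K) 0), CV j z x ∈ U1 (Matrix (Fin 2) (Fin 2) ℂ) := fun j _ z x => ref_T3_mem_U1 F V j z x
  have hCU1 : ∀ j, j ≤ K - n → ∀ (z : Site (F.P K) j) (x : Site (F.P K) 0), CU j z x ∈ U1 (Matrix (Fin 2) (Fin 2) ℂ) := fun j _ z x => ref_T3_mem_U1 F U j z x
  have hCV0 : ∀ x : Site (F.P K) 0, CV 0 x x = 1 := fun x => ref_T3_zero_self F V x
  have hCU0 : ∀ x : Site (F.P K) 0, CU 0 x x = 1 := fun x => ref_T3_zero_self F U x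
  set η : ℕ → ℝ := fun j => 4500 * (F.L : ℝ) ^ 2 * ε₀ * ((F.L : ℝ) ^ j * eta F n K) with hηdef
  have hmainV := norm_ns_sub_refMean_le_of_lt hk₀ TV hTV nsV l (fun x => by rw [h0V]) hstepV CV hCV1 hCV0 η hcloseV (K - n) le_rfl Y
  have hmainU := norm_ns_sub_refMean_le_of_lt hk₀ TU hTU nsU l (fun x => by rw [h0U]) hstepU CU hCU1 hCU0 η hcloseU (K - n) le_rfl Y
  have hδ : 2 * ∑ j ∈ range (K - n), η j ≤ 4500 * (F.L : ℝ) ^ 2 * ε₀ := two_mul_sum_eta_le_T3 F (n := n) (K := K) hε₀.le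
  set c : ℝ := ((((F.P K).L : ℝ) ^ (F.P K).d) ^ (K - n))⁻¹ with hc
  have hc0 : 0 ≤ c := by rw [hc]; have := (F.P K).L_pos; positivity
  set Ml : ℝ := ∑ x ∈ iterBlock (K - n) Y, ‖l x‖ with hMl
  have hcMl : 0 ≤ c * Ml := mul_nonneg hc0 (Finset.sum_nonneg fun _ _ => norm_nonneg _)
  -- the two reference means differ by the frame defects
  have hin : ∀ x ∈ iterBlock (K - n) Y, ‖conjR (CV (K - n) Y x) (l x) - conjR (CU (K - n) Y x) (l x)‖ ≤ (2 * δV + 2 * δU) * ‖l x‖ := by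
    intro x hx
    have h1 : ‖conjR (CV (K - n) Y x) (l x) - l x‖ ≤ 2 * δV * ‖l x‖ :=
      (norm_conjR_sub_self_le (hCV1 _ le_rfl Y x) (l x)).trans
        (mul_le_mul_of_nonneg_right (mul_le_mul_of_nonneg_left (hCV x hx) (by norm_num)) (norm_nonneg _))
    have h2 : ‖l x - conjR (CU (K - n) Y x) (l x)‖ ≤ 2 * δU * ‖l x‖ := by
      rw [norm_sub_rev]
      exact (norm_conjR_sub_self_le (hCU1 _ le_rfl Y x) (l x)).trans
        (mul_le_mul_of_nonneg_right (mul_le_mul_of_nonneg_left (hCU x hx) (by norm_num)) (norm_nonneg _))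
    calc ‖conjR (CV (K - n) Y x) (l x) - conjR (CU (K - n) Y x) (l x)‖
        ≤ ‖conjR (CV (K - n) Y x) (l x) - l x‖ + ‖l x - conjR (CU (K - n) Y x) (l x)‖ := norm_sub_le_norm_sub_add_norm_sub _ _ _
      _ ≤ 2 * δV * ‖l x‖ + 2 * δU * ‖l x‖ := add_le_add h1 h2
      _ = (2 * δV + 2 * δU) * ‖l x‖ := by ring
  have hR : ‖c • ∑ x ∈ iterBlock (K - n) Y, conjR (CV (K - n) Y x) (l x) - c • ∑ x ∈ iterBlock (K - n) Y, conjR (CU (K - n) Y x) (l x)‖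
      ≤ (2 * δV + 2 * δU) * (c * Ml) := by
    calc ‖c • ∑ x ∈ iterBlock (K - n) Y, conjR (CV (K - n) Y x) (l x) - c • ∑ x ∈ iterBlock (K - n) Y, conjR (CU (K - n) Y x) (l x)‖
        = c * ‖∑ x ∈ iterBlock (K - n) Y, (conjR (CV (K - n) Y x) (l x) - conjR (CU (K - n) Y x) (l x))‖ := by
          rw [← smul_sub, ← Finset.sum_sub_distrib, norm_smul, Real.norm_of_nonneg hc0]
      _ ≤ c * ∑ x ∈ iterBlock (K - n) Y, (2 * δV + 2 * δU) * ‖l x‖ :=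
          mul_le_mul_of_nonneg_left ((norm_sum_le _ _).trans (Finset.sum_le_sum hin)) hc0
      _ = (2 * δV + 2 * δU) * (c * Ml) := by rw [hMl, ← Finset.mul_sum]; ring
  have h1 : ‖nsV (K - n) Y - c • ∑ x ∈ iterBlock (K - n) Y, conjR (CV (K - n) Y x) (l x)‖ ≤ 4500 * (F.L : ℝ) ^ 2 * ε₀ * (c * Ml) :=
    hmainV.trans (mul_le_mul_of_nonneg_right hδ hcMl)
  have h3 : ‖c • ∑ x ∈ iterBlock (K - n) Y, conjR (CU (K - n) Y x) (l x) - nsU (K - n) Y‖ ≤ 4500 * (F.L : ℝ) ^ 2 * ε₀ * (c * Ml) := by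
    rw [norm_sub_rev]; exact hmainU.trans (mul_le_mul_of_nonneg_right hδ hcMl)
  have e : nsV (K - n) Y - nsU (K - n) Y
      = (nsV (K - n) Y - c • ∑ x ∈ iterBlock (K - n) Y, conjR (CV (K - n) Y x) (l x))
        + (c • ∑ x ∈ iterBlock (K - n) Y, conjR (CV (K - n) Y x) (l x) - c • ∑ x ∈ iterBlock (K - n) Y, conjR (CU (K - n) Y x) (l x))
        + (c • ∑ x ∈ iterBlock (K - n) Y, conjR (CU (K - n) Y x) (l x) - nsU (K - n) Y) := by abel
  rw [e]
  calc _ ≤ ‖nsV (K - n) Y - c • ∑ x ∈ iterBlock (K - n) Y, conjR (CV (K - n) Y x) (l x)‖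
        + ‖c • ∑ x ∈ iterBlock (K - n) Y, conjR (CV (K - n) Y x) (l x) - c • ∑ x ∈ iterBlock (K - n) Y, conjR (CU (K - n) Y x) (l x)‖
        + ‖c • ∑ x ∈ iterBlock (K - n) Y, conjR (CU (K - n) Y x) (l x) - nsU (K - n) Y‖ := norm_add₃_le
    _ ≤ 4500 * (F.L : ℝ) ^ 2 * ε₀ * (c * Ml) + (2 * δV + 2 * δU) * (c * Ml) + 4500 * (F.L : ℝ) ^ 2 * ε₀ * (c * Ml) :=
        add_le_add (add_le_add h1 hR) h3
    _ = (2 * (4500 * (F.L : ℝ) ^ 2 * ε₀) + 2 * δV + 2 * δU) * (c * Ml) := by ring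

/-! ## §3 The same for any two `Q″` of record -/

section TopMean

variable {c₀ : ℝ} [Fact (0 < c₀)] {ε₀ : ℝ} (hε₀ : 0 < ε₀) (hε7 : 10 ^ 7 * (F.L : ℝ) ^ 3 * ε₀ ≤ 1)
  (V : GaugeField (F.P K) 0 (Matrix.specialUnitaryGroup (Fin 2) ℂ)) (hreg : RegPr F n K ε₀ V)
  (Q'' : SiteL2K ℂ 3 (periodsT3 F K) c₀ W₂ →ₗ[ℂ] (Site (F.P K) (K - n) → Matrix (Fin 2) (Fin 2) ℂ))
  (hseq : ∀ lam : Site (F.P K) 0 → Matrix (Fin 2) (Fin 2) ℂ, ∃ ns : (j : ℕ) → Site (F.P K) j → Matrix (Fin 2) (Fin 2) ℂ, ns 0 = lam ∧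
        (∀ (j : ℕ) (y : Site (F.P K) (j + 1)), ns (j + 1) y = ns j (emb y) - meanCLM (Idx (F.P K)) (Matrix (Fin 2) (Fin 2) ℂ) fun i : Idx (F.P K) =>
          ns j (emb y) - ((holT (emlIterU j (bgUnits F K V)) (emb y) (stairWord i.2.1 (off i.1)) : (Matrix (Fin 2) (Fin 2) ℂ)ˣ) : Matrix (Fin 2) (Fin 2) ℂ) *
            ns j (transl (emb y) (disp (stairWord i.2.1 (off i.1)))) * (((holT (emlIterU j (bgUnits F K V)) (emb y) (stairWord i.2.1 (off i.1)))⁻¹ : (Matrix (Fin 2) (Fin 2) ℂ)ˣ) : Matrix (Fin 2) (Fin 2) ℂ)) ∧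
        ns (K - n) = Q'' (toL2S F K c₀ lam))
  (U : GaugeField (F.P K) 0 (Matrix.specialUnitaryGroup (Fin 2) ℂ)) (hregU : RegPr F n K ε₀ U)
  (QU : SiteL2K ℂ 3 (periodsT3 F K) c₀ W₂ →ₗ[ℂ] (Site (F.P K) (K - n) → Matrix (Fin 2) (Fin 2) ℂ))
  (hseqU : ∀ lam : Site (F.P K) 0 → Matrix (Fin 2) (Fin 2) ℂ, ∃ ns : (j : ℕ) → Site (F.P K) j → Matrix (Fin 2) (Fin 2) ℂ, ns 0 = lam ∧
        (∀ (j : ℕ) (y : Site (F.P K) (j + 1)), ns (j + 1) y = ns j (emb y) - meanCLM (Idx (F.P K)) (Matrix (Fin 2) (Fin 2) ℂ) fun i : Idx (F.P K) =>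
          ns j (emb y) - ((holT (emlIterU j (bgUnits F K U)) (emb y) (stairWord i.2.1 (off i.1)) : (Matrix (Fin 2) (Fin 2) ℂ)ˣ) : Matrix (Fin 2) (Fin 2) ℂ) *
            ns j (transl (emb y) (disp (stairWord i.2.1 (off i.1)))) * (((holT (emlIterU j (bgUnits F K U)) (emb y) (stairWord i.2.1 (off i.1)))⁻¹ : (Matrix (Fin 2) (Fin 2) ℂ)ˣ) : Matrix (Fin 2) (Fin 2) ℂ)) ∧
        ns (K - n) = QU (toL2S F K c₀ lam))

omit [Fact (0 < c₀)] in
include hε₀ hε7 hreg hseq hregU hseqU in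
/-- ★★ **TWO `Q″` OF RECORD AGREE ON A BLOCK WHOSE TWO COMB FRAMES ARE NEAR `1`**: for `Q''` of record at `V` and `QU` of record at `U` (clauses (iii)+(iv) of
✓`exists_intertwiner_of_regPr` VERBATIM for each background), every `λ` and every top block `Y` with `‖C^V_{Y,x} − 1‖ ≤ δ_V`, `‖C^U_{Y,x} − 1‖ ≤ δ_U` on `B(Y)`:
`‖(Q''(toL2S λ)) Y − (QU(toL2S λ)) Y‖ ≤ (9000L²ε₀ + 2δ_V + 2δ_U)·((L^d)^{K−n})⁻¹·Σ_{x ∈ B(Y)}‖λ x‖` (§2).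
[cite: Balaban1985Averaging, (97) p.32; Balaban1985BackgroundPropagators, (3.19) p.393, (3.24) p.394] -/
theorem norm_topMean_sub_topMean_le (lam : Site (F.P K) 0 → Matrix (Fin 2) (Fin 2) ℂ) (Y : Site (F.P K) (K - n)) {δV δU : ℝ}
    (hCV : ∀ x ∈ iterBlock (K - n) Y, ‖(((axialT (bgUnits F K V) (Site.fibreSite 0 (K - n) (iterBlockOf (K - n) x) fun _ => (⟨0, pow_pos (F.P K).L_pos (K - n)⟩ : Fin ((F.P K).L ^ (K - n)))) (embIter (K - n) Y))⁻¹ *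
          axialT (bgUnits F K V) (Site.fibreSite 0 (K - n) (iterBlockOf (K - n) x) fun _ => (⟨0, pow_pos (F.P K).L_pos (K - n)⟩ : Fin ((F.P K).L ^ (K - n)))) x : (Matrix (Fin 2) (Fin 2) ℂ)ˣ) : Matrix (Fin 2) (Fin 2) ℂ) - 1‖ ≤ δV)
    (hCU : ∀ x ∈ iterBlock (K - n) Y, ‖(((axialT (bgUnits F K U) (Site.fibreSite 0 (K - n) (iterBlockOf (K - n) x) fun _ => (⟨0, pow_pos (F.P K).L_pos (K - n)⟩ : Fin ((F.P K).L ^ (K - n)))) (embIter (K - n) Y))⁻¹ *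
          axialT (bgUnits F K U) (Site.fibreSite 0 (K - n) (iterBlockOf (K - n) x) fun _ => (⟨0, pow_pos (F.P K).L_pos (K - n)⟩ : Fin ((F.P K).L ^ (K - n)))) x : (Matrix (Fin 2) (Fin 2) ℂ)ˣ) : Matrix (Fin 2) (Fin 2) ℂ) - 1‖ ≤ δU) :
    ‖Q'' (toL2S F K c₀ lam) Y - QU (toL2S F K c₀ lam) Y‖
      ≤ (2 * (4500 * (F.L : ℝ) ^ 2 * ε₀) + 2 * δV + 2 * δU) * (((((F.P K).L : ℝ) ^ (F.P K).d) ^ (K - n))⁻¹ * ∑ x ∈ iterBlock (K - n) Y, ‖lam x‖) := by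
  obtain ⟨nsV, h0V, hsV, htV⟩ := hseq lam
  obtain ⟨nsU, h0U, hsU, htU⟩ := hseqU lam
  have h := norm_nsTop_sub_nsTop_le F hε₀ hε7 V U hreg hregU lam nsV h0V hsV nsU h0U hsU Y hCV hCU
  rw [htV, htU] at h
  exact h

/-! ## §4 The two `L²` rows `hQw`∕`hQz` of ✓`abs_re_inner_twisted_massive_le`, from frame bounds on the blocks meeting the cut-off -/

omit [Fact (0 < c₀)] in
include hseq in
/-- Block-locality at a block missing `supp χ`: `(Q''(toL2S(χ·y))) Y = 0` if `χ = 0` on `B(Y)` (✓`topMean_apply_eq_of_eqOn_iterBlock` against the zero field, linearity).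
[cite: Balaban1985BackgroundPropagators, (3.19) p.393] -/
theorem topMean_smul_apply_eq_zero (χ : Site (F.P K) 0 → ℝ) (y : Site (F.P K) 0 → Matrix (Fin 2) (Fin 2) ℂ) (Y : Site (F.P K) (K - n))
    (hY : ¬ ∃ x ∈ iterBlock (K - n) Y, χ x ≠ 0) : Q'' (toL2S F K c₀ fun x => χ x • y x) Y = 0 := by
  have h := topMean_apply_eq_of_eqOn_iterBlock F V Q'' hseq (fun x => χ x • y x) 0 Y (fun x hx => by
    have hx' : x ∈ iterBlock (K - n) Y := (mem_iterBlock (K - n) Y x).mpr hx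
    have hχ : χ x = 0 := by by_contra hne; exact hY ⟨x, hx', hne⟩
    simp only [hχ, zero_smul, Pi.zero_apply])
  rw [h, map_zero, map_zero, Pi.zero_apply]

/-- ★ **BLOCKWISE `ℓ¹`-MEAN BOUNDS LIFT TO `L²`** (the Cauchy–Schwarz-per-block step of ✓`normSq_lift_topMean_le`, with a free constant): if a coarse section `d` satisfies
`‖d Y‖ ≤ δ·((L^d)^{K−n})⁻¹·Σ_{x∈B(Y)}‖g x‖` at every block, then `‖toL2S F n c₁ (d ∘ siteShift)‖² ≤ 2δ²·κ·‖toL2S g‖²`, `κ = c₁((L^d)^{K−n})⁻¹∕c₀`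
(`#B(Y) = (L^d)^{K−n}`, Frobenius `≤ 2·`op² on `M₂`, op² `≤` Frobenius). [cite: Balaban1985BackgroundPropagators, (3.16) p.393, (3.24) p.394] -/
theorem normSq_lift_le_of_blockwise (h : n ≤ K) {c₁ : ℝ} [Fact (0 < c₁)] (d : Site (F.P K) (K - n) → Matrix (Fin 2) (Fin 2) ℂ) (g : Site (F.P K) 0 → Matrix (Fin 2) (Fin 2) ℂ) {δ : ℝ}
    (hd : ∀ Y : Site (F.P K) (K - n), ‖d Y‖ ≤ δ * (((((F.P K).L : ℝ) ^ (F.P K).d) ^ (K - n))⁻¹ * ∑ x ∈ iterBlock (K - n) Y, ‖g x‖)) :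
    ‖toL2S F n c₁ (fun z => d (siteShift (sites_eq F n K h) z))‖ ^ 2 ≤ 2 * δ ^ 2 * (c₁ * ((((F.P K).L : ℝ) ^ (F.P K).d) ^ (K - n))⁻¹ / c₀) * ‖toL2S F K c₀ g‖ ^ 2 := by
  have hc₀ : 0 < c₀ := Fact.out
  have hc₁ : 0 < c₁ := Fact.out
  have hk : K - n ≤ (F.P K).m + (F.P K).K := by show K - n ≤ F.m + K; have := F.hm; omega
  set c : ℝ := ((((F.P K).L : ℝ) ^ (F.P K).d) ^ (K - n))⁻¹ with hc
  have hLd : (0 : ℝ) < (((F.P K).L : ℝ) ^ (F.P K).d) ^ (K - n) := by have := (F.P K).L_pos; positivity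
  have hc0 : 0 < c := by rw [hc]; positivity
  have hcard : ∀ y : Site (F.P K) (K - n), ((iterBlock (K - n) y).card : ℝ) = c⁻¹ := fun y => by
    rw [B5Eq118OneStroke.card_iterBlock (K - n) hk y, hc, inv_inv]; push_cast; ring
  rw [normSq_toL2S_comp_siteShift_eq F h, norm_sq_toL2S]
  have hblock : ∀ y : Site (F.P K) (K - n), ∑ j : Fin 2, ∑ k : Fin 2, ‖d y j k‖ ^ 2 ≤ 2 * δ ^ 2 * c * ∑ x ∈ iterBlock (K - n) y, ‖g x‖ ^ 2 := by
    intro y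
    have h1 : ∑ j : Fin 2, ∑ k : Fin 2, ‖d y j k‖ ^ 2 ≤ 2 * ‖d y‖ ^ 2 := by
      have := sum_norm_sq_le_mul_opNorm_sq (N := 2) (d y)
      simpa using this
    have hM0 : 0 ≤ ∑ x ∈ iterBlock (K - n) y, ‖g x‖ := Finset.sum_nonneg fun _ _ => norm_nonneg _
    have h3 : ‖d y‖ ^ 2 ≤ (δ * (c * ∑ x ∈ iterBlock (K - n) y, ‖g x‖)) ^ 2 := pow_le_pow_left₀ (norm_nonneg _) (hd y) 2
    have h4 : (∑ x ∈ iterBlock (K - n) y, ‖g x‖) ^ 2 ≤ (iterBlock (K - n) y).card * ∑ x ∈ iterBlock (K - n) y, ‖g x‖ ^ 2 := by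
      have := sq_sum_le_card_mul_sum_sq (s := iterBlock (K - n) y) (f := fun x => ‖g x‖)
      simpa using this
    rw [hcard y] at h4
    have h5 : (δ * (c * ∑ x ∈ iterBlock (K - n) y, ‖g x‖)) ^ 2 ≤ δ ^ 2 * c * ∑ x ∈ iterBlock (K - n) y, ‖g x‖ ^ 2 := by
      have e : (δ * (c * ∑ x ∈ iterBlock (K - n) y, ‖g x‖)) ^ 2 = δ ^ 2 * c * (c * (∑ x ∈ iterBlock (K - n) y, ‖g x‖) ^ 2) := by ring
      rw [e]
      refine mul_le_mul_of_nonneg_left ?_ (by positivity)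
      calc c * (∑ x ∈ iterBlock (K - n) y, ‖g x‖) ^ 2 ≤ c * (c⁻¹ * ∑ x ∈ iterBlock (K - n) y, ‖g x‖ ^ 2) := mul_le_mul_of_nonneg_left h4 hc0.le
        _ = ∑ x ∈ iterBlock (K - n) y, ‖g x‖ ^ 2 := by rw [← mul_assoc, mul_inv_cancel₀ hc0.ne', one_mul]
    linarith
  have hsum : ∑ Y : Site (F.P K) (K - n), ∑ j : Fin 2, ∑ k : Fin 2, ‖d Y j k‖ ^ 2 ≤ 2 * δ ^ 2 * c * ∑ x : Site (F.P K) 0, ‖g x‖ ^ 2 := by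
    rw [sum_eq_sum_iterBlock (k := K - n) (fun x => ‖g x‖ ^ 2), Finset.mul_sum]
    exact Finset.sum_le_sum fun y _ => hblock y
  have hop : ∑ x : Site (F.P K) 0, ‖g x‖ ^ 2 ≤ ∑ x : Site (F.P K) 0, ∑ j : Fin 2, ∑ k : Fin 2, ‖g x j k‖ ^ 2 :=
    Finset.sum_le_sum fun x _ => MatrixNorms.opNorm_sq_le_sum_norm_sq (g x)
  have h2δ : 0 ≤ 2 * δ ^ 2 * c := by positivity
  calc c₁ * ∑ Y : Site (F.P K) (K - n), ∑ j : Fin 2, ∑ k : Fin 2, ‖d Y j k‖ ^ 2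
      ≤ c₁ * (2 * δ ^ 2 * c * ∑ x : Site (F.P K) 0, ∑ j : Fin 2, ∑ k : Fin 2, ‖g x j k‖ ^ 2) :=
        mul_le_mul_of_nonneg_left (hsum.trans (mul_le_mul_of_nonneg_left hop h2δ)) hc₁.le
    _ = 2 * δ ^ 2 * (c₁ * c / c₀) * (c₀ * ∑ x : Site (F.P K) 0, ∑ j : Fin 2, ∑ k : Fin 2, ‖g x j k‖ ^ 2) := by
        field_simp
    _ = _ := by rfl

variable (h : n ≤ K) {c₁ : ℝ} [Fact (0 < c₁)]
  (ι : (Site (F.P K) (K - n) → Matrix (Fin 2) (Fin 2) ℂ) →ₗ[ℂ] SiteL2K ℂ 3 (periodsT3 F n) c₁ W₂)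
  (hι : ∀ c, ι c = toL2S F n c₁ (fun z => c (siteShift (sites_eq F n K h) z)))

include hε₀ hε7 hreg hseq hregU hseqU hι in
/-- ★★★ **THE ROW `hQw` OF ✓`abs_re_inner_twisted_massive_le`, SUPPLIED**: `|χ| ≤ 1`; on every block `Y` MEETING `supp χ` the two corner-comb frames satisfy `‖C^V − 1‖ ≤ δ_V`,
`‖C^U − 1‖ ≤ δ_U` (`0 ≤ δ_V, δ_U`); then for every `y`,
`‖ι(Q''(toL2S(χ·y))) − ι(QU(toL2S(χ·y)))‖ ≤ √(2κ)·(9000L²ε₀ + 2δ_V + 2δ_U)·‖toL2S y‖`, `κ = c₁((L^d)^{K−n})⁻¹∕c₀` (§3 on the blocks meeting `supp χ`, zero elsewhere by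
block-locality, ✓`normSq_lift_le_of_blockwise`, `‖toL2S(χ·y)‖ ≤ ‖toL2S y‖`). [cite: Balaban1985BackgroundPropagators, (3.16) p.393, (3.19) p.393, (3.24) p.394; Balaban1985Averaging, (97) p.32] -/
theorem norm_lift_topMean_sub_le (χ : Site (F.P K) 0 → ℝ) (hχ1 : ∀ x, |χ x| ≤ 1) {δV δU : ℝ} (hδV : 0 ≤ δV) (hδU : 0 ≤ δU)
    (hCV : ∀ Y : Site (F.P K) (K - n), (∃ x ∈ iterBlock (K - n) Y, χ x ≠ 0) → ∀ x ∈ iterBlock (K - n) Y, ‖(((axialT (bgUnits F K V) (Site.fibreSite 0 (K - n) (iterBlockOf (K - n) x) fun _ => (⟨0, pow_pos (F.P K).L_pos (K - n)⟩ : Fin ((F.P K).L ^ (K - n)))) (embIter (K - n) Y))⁻¹ *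
          axialT (bgUnits F K V) (Site.fibreSite 0 (K - n) (iterBlockOf (K - n) x) fun _ => (⟨0, pow_pos (F.P K).L_pos (K - n)⟩ : Fin ((F.P K).L ^ (K - n)))) x : (Matrix (Fin 2) (Fin 2) ℂ)ˣ) : Matrix (Fin 2) (Fin 2) ℂ) - 1‖ ≤ δV)
    (hCU : ∀ Y : Site (F.P K) (K - n), (∃ x ∈ iterBlock (K - n) Y, χ x ≠ 0) → ∀ x ∈ iterBlock (K - n) Y, ‖(((axialT (bgUnits F K U) (Site.fibreSite 0 (K - n) (iterBlockOf (K - n) x) fun _ => (⟨0, pow_pos (F.P K).L_pos (K - n)⟩ : Fin ((F.P K).L ^ (K - n)))) (embIter (K - n) Y))⁻¹ *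
          axialT (bgUnits F K U) (Site.fibreSite 0 (K - n) (iterBlockOf (K - n) x) fun _ => (⟨0, pow_pos (F.P K).L_pos (K - n)⟩ : Fin ((F.P K).L ^ (K - n)))) x : (Matrix (Fin 2) (Fin 2) ℂ)ˣ) : Matrix (Fin 2) (Fin 2) ℂ) - 1‖ ≤ δU)
    (y : Site (F.P K) 0 → Matrix (Fin 2) (Fin 2) ℂ) :
    ‖ι (Q'' (toL2S F K c₀ fun x => χ x • y x)) - ι (QU (toL2S F K c₀ fun x => χ x • y x))‖
      ≤ Real.sqrt (2 * (c₁ * ((((F.P K).L : ℝ) ^ (F.P K).d) ^ (K - n))⁻¹ / c₀)) * (2 * (4500 * (F.L : ℝ) ^ 2 * ε₀) + 2 * δV + 2 * δU) * ‖toL2S F K c₀ y‖ := by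
  have hc₀ : 0 < c₀ := Fact.out
  have hc₁ : 0 < c₁ := Fact.out
  set δ : ℝ := 2 * (4500 * (F.L : ℝ) ^ 2 * ε₀) + 2 * δV + 2 * δU with hδdef
  have hδ0 : 0 ≤ δ := by rw [hδdef]; positivity
  set κ : ℝ := (c₁ * ((((F.P K).L : ℝ) ^ (F.P K).d) ^ (K - n))⁻¹ / c₀) with hκ
  have hκ0 : 0 ≤ κ := by rw [hκ]; have := (F.P K).L_pos; positivity
  set d : Site (F.P K) (K - n) → Matrix (Fin 2) (Fin 2) ℂ := fun Y => Q'' (toL2S F K c₀ fun x => χ x • y x) Y - QU (toL2S F K c₀ fun x => χ x • y x) Y with hd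
  have hιd : ι (Q'' (toL2S F K c₀ fun x => χ x • y x)) - ι (QU (toL2S F K c₀ fun x => χ x • y x)) = toL2S F n c₁ (fun z => d (siteShift (sites_eq F n K h) z)) := by
    rw [← map_sub, hι]; rfl
  have hdY : ∀ Y : Site (F.P K) (K - n), ‖d Y‖ ≤ δ * (((((F.P K).L : ℝ) ^ (F.P K).d) ^ (K - n))⁻¹ * ∑ x ∈ iterBlock (K - n) Y, ‖χ x • y x‖) := by
    intro Y
    by_cases hY : ∃ x ∈ iterBlock (K - n) Y, χ x ≠ 0
    · exact norm_topMean_sub_topMean_le F hε₀ hε7 V hreg Q'' hseq U hregU QU hseqU (fun x => χ x • y x) Y (hCV Y hY) (hCU Y hY)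
    · have : d Y = 0 := by
        simp only [hd, topMean_smul_apply_eq_zero F V Q'' hseq χ y Y hY, topMean_smul_apply_eq_zero F U QU hseqU χ y Y hY, sub_zero]
      rw [this, norm_zero]
      have := (F.P K).L_pos
      exact mul_nonneg hδ0 (mul_nonneg (by positivity) (Finset.sum_nonneg fun _ _ => norm_nonneg _))
  have hsq := normSq_lift_le_of_blockwise F (c₀ := c₀) (c₁ := c₁) h d (fun x => χ x • y x) hdY
  have hsm := norm_toL2S_smul_le F (c₀ := c₀) χ zero_le_one hχ1 y
  rw [one_mul] at hsm; have hT0 : 0 ≤ Real.sqrt (2 * κ) * δ * ‖toL2S F K c₀ y‖ := by positivity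
  have hsq' : ‖toL2S F n c₁ (fun z => d (siteShift (sites_eq F n K h) z))‖ ^ 2 ≤ (Real.sqrt (2 * κ) * δ * ‖toL2S F K c₀ y‖) ^ 2 := by
    have e : (Real.sqrt (2 * κ) * δ * ‖toL2S F K c₀ y‖) ^ 2 = 2 * δ ^ 2 * κ * ‖toL2S F K c₀ y‖ ^ 2 := by
      rw [mul_pow, mul_pow, Real.sq_sqrt (by positivity)]; ring
    rw [e]
    refine hsq.trans ?_
    have : ‖toL2S F K c₀ (fun x => χ x • y x)‖ ^ 2 ≤ ‖toL2S F K c₀ y‖ ^ 2 := pow_le_pow_left₀ (norm_nonneg _) hsm 2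
    exact mul_le_mul_of_nonneg_left this (by positivity)
  rw [hιd]
  have := Real.sqrt_le_sqrt hsq'
  rwa [Real.sqrt_sq (norm_nonneg _), Real.sqrt_sq hT0] at this

include hε₀ hε7 hreg hseq hregU hseqU hι in
/-- ★★★ **THE ROW `hQz` OF ✓`abs_re_inner_twisted_massive_le`, SUPPLIED**: under the same frame hypotheses on the blocks meeting `supp χ`, for every `y`, `y′`,
`‖⟪ι(Q''(toL2S y)) − ι(QU(toL2S y)), ι(Q''(toL2S(χ·y′)))⟫‖ ≤ (√(2κ)·(9000L²ε₀ + 2δ_V + 2δ_U))·√(25κ∕8)·‖toL2S y‖·‖toL2S y′‖` — the second factor lives on the blocks meeting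
`supp χ` (block-locality), lifts with disjoint block supports are orthogonal (✓`inner_blockLift_eq_zero_of_disjoint`), the masked difference obeys ✓`normSq_lift_le_of_blockwise`, and
`‖ι(Q''(toL2S(χ·y′)))‖ ≤ √(25κ∕8)‖toL2S y′‖` (✓`normSq_lift_topMean_le`). [cite: Balaban1985BackgroundPropagators, (3.16) p.393, (3.19) p.393, (3.24) p.394; Balaban1985Averaging, (97) p.32] -/
theorem norm_inner_lift_topMean_sub_le (χ : Site (F.P K) 0 → ℝ) (hχ1 : ∀ x, |χ x| ≤ 1) {δV δU : ℝ} (hδV : 0 ≤ δV) (hδU : 0 ≤ δU)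
    (hCV : ∀ Y : Site (F.P K) (K - n), (∃ x ∈ iterBlock (K - n) Y, χ x ≠ 0) → ∀ x ∈ iterBlock (K - n) Y, ‖(((axialT (bgUnits F K V) (Site.fibreSite 0 (K - n) (iterBlockOf (K - n) x) fun _ => (⟨0, pow_pos (F.P K).L_pos (K - n)⟩ : Fin ((F.P K).L ^ (K - n)))) (embIter (K - n) Y))⁻¹ *
          axialT (bgUnits F K V) (Site.fibreSite 0 (K - n) (iterBlockOf (K - n) x) fun _ => (⟨0, pow_pos (F.P K).L_pos (K - n)⟩ : Fin ((F.P K).L ^ (K - n)))) x : (Matrix (Fin 2) (Fin 2) ℂ)ˣ) : Matrix (Fin 2) (Fin 2) ℂ) - 1‖ ≤ δV)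
    (hCU : ∀ Y : Site (F.P K) (K - n), (∃ x ∈ iterBlock (K - n) Y, χ x ≠ 0) → ∀ x ∈ iterBlock (K - n) Y, ‖(((axialT (bgUnits F K U) (Site.fibreSite 0 (K - n) (iterBlockOf (K - n) x) fun _ => (⟨0, pow_pos (F.P K).L_pos (K - n)⟩ : Fin ((F.P K).L ^ (K - n)))) (embIter (K - n) Y))⁻¹ *
          axialT (bgUnits F K U) (Site.fibreSite 0 (K - n) (iterBlockOf (K - n) x) fun _ => (⟨0, pow_pos (F.P K).L_pos (K - n)⟩ : Fin ((F.P K).L ^ (K - n)))) x : (Matrix (Fin 2) (Fin 2) ℂ)ˣ) : Matrix (Fin 2) (Fin 2) ℂ) - 1‖ ≤ δU)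
    (y y' : Site (F.P K) 0 → Matrix (Fin 2) (Fin 2) ℂ) :
    ‖⟪ι (Q'' (toL2S F K c₀ y)) - ι (QU (toL2S F K c₀ y)), ι (Q'' (toL2S F K c₀ fun x => χ x • y' x))⟫_ℂ‖
      ≤ (Real.sqrt (2 * (c₁ * ((((F.P K).L : ℝ) ^ (F.P K).d) ^ (K - n))⁻¹ / c₀)) * (2 * (4500 * (F.L : ℝ) ^ 2 * ε₀) + 2 * δV + 2 * δU))
        * Real.sqrt ((25 / 8) * (c₁ * ((((F.P K).L : ℝ) ^ (F.P K).d) ^ (K - n))⁻¹ / c₀)) * ‖toL2S F K c₀ y‖ * ‖toL2S F K c₀ y'‖ := by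
  classical
  have hc₀ : 0 < c₀ := Fact.out
  have hc₁ : 0 < c₁ := Fact.out
  set δ : ℝ := 2 * (4500 * (F.L : ℝ) ^ 2 * ε₀) + 2 * δV + 2 * δU with hδdef
  have hδ0 : 0 ≤ δ := by rw [hδdef]; positivity
  set κ : ℝ := (c₁ * ((((F.P K).L : ℝ) ^ (F.P K).d) ^ (K - n))⁻¹ / c₀) with hκ
  have hκ0 : 0 ≤ κ := by rw [hκ]; have := (F.P K).L_pos; positivity
  set d : Site (F.P K) (K - n) → Matrix (Fin 2) (Fin 2) ℂ := fun Y => Q'' (toL2S F K c₀ y) Y - QU (toL2S F K c₀ y) Y with hd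
  set dM : Site (F.P K) (K - n) → Matrix (Fin 2) (Fin 2) ℂ := fun Y => if (∃ x ∈ iterBlock (K - n) Y, χ x ≠ 0) then d Y else 0 with hdM
  set dC : Site (F.P K) (K - n) → Matrix (Fin 2) (Fin 2) ℂ := fun Y => if (∃ x ∈ iterBlock (K - n) Y, χ x ≠ 0) then 0 else d Y with hdC
  set c' : Site (F.P K) (K - n) → Matrix (Fin 2) (Fin 2) ℂ := Q'' (toL2S F K c₀ fun x => χ x • y' x) with hc'
  have hsplit : Q'' (toL2S F K c₀ y) - QU (toL2S F K c₀ y) = dM + dC := by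
    funext Y
    simp only [Pi.sub_apply, Pi.add_apply, hdM, hdC, hd]
    split_ifs <;> simp
  have hιsplit : ι (Q'' (toL2S F K c₀ y)) - ι (QU (toL2S F K c₀ y)) = ι dM + ι dC := by
    rw [← map_sub, hsplit, map_add]
  have horth : ⟪ι dC, ι c'⟫_ℂ = 0 := by
    rw [hι, hι]
    refine inner_blockLift_eq_zero_of_disjoint F h dC c' fun Y => ?_
    by_cases hY : ∃ x ∈ iterBlock (K - n) Y, χ x ≠ 0
    · left; simp only [hdC, if_pos hY]
    · right; rw [hc']; exact topMean_smul_apply_eq_zero F V Q'' hseq χ y' Y hY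
  have hdMY : ∀ Y : Site (F.P K) (K - n), ‖dM Y‖ ≤ δ * (((((F.P K).L : ℝ) ^ (F.P K).d) ^ (K - n))⁻¹ * ∑ x ∈ iterBlock (K - n) Y, ‖y x‖) := by
    intro Y
    by_cases hY : ∃ x ∈ iterBlock (K - n) Y, χ x ≠ 0
    · simp only [hdM, if_pos hY, hd]
      exact norm_topMean_sub_topMean_le F hε₀ hε7 V hreg Q'' hseq U hregU QU hseqU y Y (hCV Y hY) (hCU Y hY)
    · simp only [hdM, if_neg hY, norm_zero]
      have := (F.P K).L_pos
      exact mul_nonneg hδ0 (mul_nonneg (by positivity) (Finset.sum_nonneg fun _ _ => norm_nonneg _))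
  have hsqM := normSq_lift_le_of_blockwise F (c₀ := c₀) (c₁ := c₁) h dM y hdMY
  have hM0 : 0 ≤ Real.sqrt (2 * κ) * δ * ‖toL2S F K c₀ y‖ := by positivity
  have hnM : ‖ι dM‖ ≤ Real.sqrt (2 * κ) * δ * ‖toL2S F K c₀ y‖ := by
    rw [hι]
    have e : (Real.sqrt (2 * κ) * δ * ‖toL2S F K c₀ y‖) ^ 2 = 2 * δ ^ 2 * κ * ‖toL2S F K c₀ y‖ ^ 2 := by
      rw [mul_pow, mul_pow, Real.sq_sqrt (by positivity)]; ring
    have hsq' : ‖toL2S F n c₁ (fun z => dM (siteShift (sites_eq F n K h) z))‖ ^ 2 ≤ (Real.sqrt (2 * κ) * δ * ‖toL2S F K c₀ y‖) ^ 2 := by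
      rw [e]; exact hsqM
    have := Real.sqrt_le_sqrt hsq'
    rwa [Real.sqrt_sq (norm_nonneg _), Real.sqrt_sq hM0] at this
  have hn' : ‖ι c'‖ ≤ Real.sqrt ((25 / 8) * κ) * ‖toL2S F K c₀ y'‖ := by
    rw [hc', hι]
    have hsq := normSq_lift_topMean_le F V Q'' hseq h (c₁ := c₁) hε₀ hε7 hreg (fun x => χ x • y' x)
    have hsm := norm_toL2S_smul_le F (c₀ := c₀) χ zero_le_one hχ1 y'
    rw [one_mul] at hsm; have h0 : 0 ≤ Real.sqrt ((25 / 8) * κ) * ‖toL2S F K c₀ y'‖ := by positivity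
    have hsq' : ‖toL2S F n c₁ (fun z => Q'' (toL2S F K c₀ fun x => χ x • y' x) (siteShift (sites_eq F n K h) z))‖ ^ 2
        ≤ (Real.sqrt ((25 / 8) * κ) * ‖toL2S F K c₀ y'‖) ^ 2 := by
      rw [mul_pow, Real.sq_sqrt (by positivity)]
      exact hsq.trans (mul_le_mul_of_nonneg_left (pow_le_pow_left₀ (norm_nonneg _) hsm 2) (by positivity))
    have := Real.sqrt_le_sqrt hsq'
    rwa [Real.sqrt_sq (norm_nonneg _), Real.sqrt_sq h0] at this
  rw [hιsplit, inner_add_left, horth, add_zero]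
  calc ‖⟪ι dM, ι c'⟫_ℂ‖ ≤ ‖ι dM‖ * ‖ι c'‖ := norm_inner_le_norm _ _
    _ ≤ (Real.sqrt (2 * κ) * δ * ‖toL2S F K c₀ y‖) * (Real.sqrt ((25 / 8) * κ) * ‖toL2S F K c₀ y'‖) :=
        mul_le_mul hnM hn' (norm_nonneg _) hM0
    _ = _ := by ring

end TopMean

end Summit.QuantumFields.YangMills.Theorems.Prop7TopMeanTwoBackgrounds
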